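import Literature.Barriers.AtomisticToContinuum.DisorderedHarmonicChainCovariance
import HarnessLib

/-!
# The stationary covariance of the Casher–Lebowitz chain is positive definite

Companion to `DisorderedHarmonicChainCovariance.lean` (barrier catalogue
`Literature/Barriers/AtomisticToContinuum/`, sub-problem `FouriersLaw`; provefact unit of
`AjankiHuveneers2011_scaling`, bottom-up step towards the named fact
`CasherLebowitz1971_steadyState` = (F1a)): the non-degeneracy of the Lyapunov covariance
`clCov m λ T_L T_R` for `T_L, T_R > 0`, so that the stationary Gaussian state has a density
`∝ e^{-½ x♭ᵀ (clCov)⁻¹ x♭}`. All PROVED, following the unit-mass `chainCov_posDef` of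
`HarmonicChainCovariance.lean`:

* `clGibbsCov_posDef` — the Gibbs covariance `[[Φ_D⁻¹, 0], [0, M]]` is positive definite;
* `clCov_mulVec_eq_zero` — CONTROLLABILITY: for `T_L > 0`, `T_R ≥ 0` the covariance has trivial
  kernel (a kernel vector spans an `Aᵀ`-invariant subspace killed by the noise, hence containing
  an eigenvector of `Aᵀ` with a node at the left bath site; its momentum part solves
  `Φ_D w + (c²M + cλEM) w = 0` and vanishes by propagation along the chain);
* `clCov_posDef` — positivity propagates from the Gibbs anchor `B(T_L,T_L) = T_L·G` along the
  segment of temperatures (`posDef_of_segment`).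

## References

Dhar 2008, §3.1 ("the steady state is given by the Gaussian distribution
`P({q_l}) = (2π)^{-N} Det[B̂]^{-1/2} e^{-½ qᵀ B̂⁻¹ q}`", which presupposes `B̂` invertible);
Rieder–Lebowitz–Lieb 1967 (Gaussian stationary state with density).
-/

noncomputable section

open Matrix Complex

namespace Literature.Barriers.AtomisticToContinuum.HeatConduction

open Literature.MathematicalPhysics.KineticTheory.HeatConduction

variable {n : ℕ}

/-! ### The Gibbs covariance is positive definite -/

/-- **The Gibbs covariance `[[Φ_D⁻¹, 0], [0, M]]` is positive definite** (`m > 0`). [folklore] -/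
theorem clGibbsCov_posDef {m : Fin n → ℝ} (hm : ∀ k, 0 < m k) : (clGibbsCov m).PosDef := by
  have hΦ := (clForceMatrix_posDef n).inv
  have hΦT : ((clForceMatrix n : Matrix (Fin n) (Fin n) ℝ)⁻¹)ᵀ = (clForceMatrix n)⁻¹ := by
    rw [transpose_nonsing_inv, clForceMatrix_transpose]
  refine Matrix.PosDef.of_dotProduct_mulVec_pos ?_ fun x hx => ?_
  · rw [Matrix.IsHermitian, conjTranspose_eq_transpose_of_trivial, clGibbsCov, fromBlocks_transpose,
      transpose_zero, diagonal_transpose, hΦT]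
  · rw [star_trivial]
    set u : Fin n → ℝ := fun i => x (Sum.inl i)
    set w : Fin n → ℝ := fun i => x (Sum.inr i)
    have hx_eq : x = Sum.elim u w := by
      ext i; rcases i with i | i <;> rfl
    rw [hx_eq, clGibbsCov, fromBlocks_mulVec, sumElim_dotProduct_sumElim]
    simp only [Sum.elim_comp_inl, Sum.elim_comp_inr, zero_mulVec, add_zero, zero_add]
    have hw_nn : 0 ≤ w ⬝ᵥ (Matrix.diagonal m *ᵥ w) := by
      simp only [dotProduct, mulVec_diagonal]
      exact Finset.sum_nonneg fun i _ => by nlinarith [hm i, mul_self_nonneg (w i)]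
    by_cases hu : u = 0
    · have hw : w ≠ 0 := by
        intro hw
        apply hx
        rw [hx_eq, hu, hw]
        ext i; cases i <;> rfl
      rw [hu, zero_dotProduct, zero_add]
      obtain ⟨i, hi⟩ : ∃ i, w i ≠ 0 := by
        by_contra hall
        push Not at hall
        exact hw (funext hall)
      simp only [dotProduct, mulVec_diagonal]
      have hterm : 0 < w i * (m i * w i) := by
        have := hm i
        have h2 : 0 < w i * w i := mul_self_pos.mpr hi
        nlinarith
      exact lt_of_lt_of_le hterm (Finset.single_le_sum (f := fun j => w j * (m j * w j))
        (fun j _ => by nlinarith [hm j, mul_self_nonneg (w j)]) (Finset.mem_univ i))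
    · have h1 := hΦ.dotProduct_mulVec_pos hu
      rw [star_trivial] at h1
      linarith

/-! ### Controllability: trivial kernel of the covariance -/

/-- Complexification of the noise matrix. [folklore] -/
theorem clNoiseMatrix_map_ofReal (m : Fin n → ℝ) (lam T_L T_R : ℝ) :
    (clNoiseMatrix m lam T_L T_R).map (algebraMap ℝ ℂ) =
      Matrix.fromBlocks 0 0 0
        (Matrix.diagonal fun i => ((2 * lam * m i * bathTemp n T_L T_R i : ℝ) : ℂ)) := by
  rw [clNoiseMatrix, fromBlocks_map, Matrix.map_zero _ (map_zero _)]
  congr 1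
  ext i j
  simp only [map_apply, diagonal_apply, Complex.coe_algebraMap]
  split_ifs <;> simp

/-- **Controllability: the stationary covariance has trivial kernel as soon as the left bath is
active** (`m > 0`, `λ > 0`, `T_L > 0`, `T_R ≥ 0`). If `B v = 0` on a non-zero subspace `K`,
then `K` is `Aᵀ`-invariant and killed by the noise (`v⋆ Σ v = -v⋆(AB + BAᵀ)v = 0`), so it
contains a complex eigenvector `(u, w)` of `Aᵀ` with vanishing `p_0`-component; the eigenvector
equation gives `u = M(c w + λ E w)` and `Φ_D w + (c² M + c λ E M) w = 0`, whence `w = 0` by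
propagation along the chain, and `u = 0`. [folklore] -/
theorem clCov_mulVec_eq_zero {m : Fin n → ℝ} (hm : ∀ k, 0 < m k) {lam : ℝ} (hlam : 0 < lam)
    {T_L T_R : ℝ} (hL : 0 < T_L) (hR : 0 ≤ T_R) {x : Fin n ⊕ Fin n → ℝ}
    (hx : clCov m lam T_L T_R *ᵥ x = 0) : x = 0 := by
  by_contra hx0
  -- notation and complexification
  set C := clCov m lam T_L T_R with hC
  set f := algebraMap ℝ ℂ with hf
  set φ : Matrix (Fin n ⊕ Fin n) (Fin n ⊕ Fin n) ℝ →+* Matrix (Fin n ⊕ Fin n) (Fin n ⊕ Fin n) ℂ :=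
    f.mapMatrix with hφ
  set Cc := φ C with hCc
  set Ac := φ (clDriftMatrix m lam) with hAc
  set Sc := φ (clNoiseMatrix m lam T_L T_R) with hSc
  have hCc' : Cc = C.map f := rfl
  have hAc' : Ac = Matrix.fromBlocks 0 (Matrix.diagonal fun i => ((m i : ℂ))⁻¹) (-clForceMatrix n)
      (-frictionMatrix (lam : ℂ) n) := by
    rw [hAc, RingHom.mapMatrix_apply, hf, clDriftMatrix_map_ofReal]
  have hAcT : Acᵀ = Matrix.fromBlocks 0 (-clForceMatrix n) (Matrix.diagonal fun i => ((m i : ℂ))⁻¹)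
      (-frictionMatrix (lam : ℂ) n) := by
    rw [hAc', fromBlocks_transpose, transpose_zero, transpose_neg, transpose_neg,
      clForceMatrix_transpose, diagonal_transpose, frictionMatrix_transpose]
  have hSc' : Sc = Matrix.fromBlocks 0 0 0
      (Matrix.diagonal fun i => ((2 * lam * m i * bathTemp n T_L T_R i : ℝ) : ℂ)) := by
    rw [hSc, RingHom.mapMatrix_apply, hf, clNoiseMatrix_map_ofReal]
  have hCT : Cᵀ = C := clCov_transpose hm hlam T_L T_R
  have hsym : ∀ i j, C j i = C i j := fun i j => by
    have := congrFun (congrFun hCT i) j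
    rwa [transpose_apply] at this
  have hCcH : Ccᴴ = Cc := by
    ext i j
    simp only [conjTranspose_apply, hCc', map_apply, hsym i j, hf, Complex.coe_algebraMap,
      Complex.star_def, Complex.conj_ofReal]
  have hlyap : Ac * Cc + Cc * Acᵀ + Sc = 0 := by
    have h := congrArg φ (clCov_lyapunov hm hlam T_L T_R)
    rw [map_add, map_add, map_mul, map_mul, map_zero] at h
    have hT : φ (clDriftMatrix m lam)ᵀ = Acᵀ := by
      rw [hAc, RingHom.mapMatrix_apply, RingHom.mapMatrix_apply, transpose_map]
    rw [hT] at h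
    exact h
  -- the kernel of `Cc`
  set K : Submodule ℂ (Fin n ⊕ Fin n → ℂ) := LinearMap.ker (Matrix.toLin' Cc) with hK
  have hmemK : ∀ w, w ∈ K ↔ Cc *ᵥ w = 0 := fun w => by
    rw [hK, LinearMap.mem_ker, Matrix.toLin'_apply]
  have hxK : (f ∘ x) ∈ K := by
    rw [hmemK]
    funext i
    have := RingHom.map_mulVec f C x i
    rw [← hCc'] at this
    rw [← this, hx]
    simp [hf]
  have hxne : (f ∘ x) ≠ 0 := by
    intro h0
    apply hx0
    funext i
    have := congrFun h0 i
    simpa [hf] using this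
  have hKne : K ≠ ⊥ := fun hbot => hxne ((Submodule.mem_bot ℂ).mp (hbot ▸ hxK))
  -- for `w ∈ K`: `w⋆ Σ w = 0`, hence `Σ w = 0` and the `p_0`-component of `w` vanishes
  have hdiag_nn : ∀ i : Fin n, 0 ≤ 2 * lam * m i * bathTemp n T_L T_R i := by
    intro i
    have := hm i
    have hbt : 0 ≤ bathTemp n T_L T_R i := by
      simp only [bathTemp]
      split_ifs <;> linarith
    positivity
  have hnoise : ∀ w ∈ K, ∀ i : Fin n,
      (2 * lam * m i * bathTemp n T_L T_R i) * Complex.normSq (w (Sum.inr i)) = 0 := by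
    intro w hw
    rw [hmemK] at hw
    have hwC : ∀ z, star w ⬝ᵥ (Cc *ᵥ z) = 0 := by
      intro z
      rw [dotProduct_mulVec, ← star_star (star w ᵥ* Cc), star_vecMul, hCcH, star_star, hw,
        star_zero, zero_dotProduct]
    have h0 : star w ⬝ᵥ (Sc *ᵥ w) = 0 := by
      have := congrArg (fun M => star w ⬝ᵥ (M *ᵥ w)) hlyap
      simp only [add_mulVec, dotProduct_add, zero_mulVec, dotProduct_zero, ← mulVec_mulVec, hw,
        mulVec_zero, hwC] at this
      simpa using this
    rw [hSc', fromBlocks_mulVec] at h0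
    have hsplit : w = Sum.elim (fun i => w (Sum.inl i)) (fun i => w (Sum.inr i)) := by
      ext i; rcases i with i | i <;> rfl
    rw [hsplit] at h0
    simp only [Sum.elim_comp_inl, Sum.elim_comp_inr, zero_mulVec, zero_add] at h0
    rw [show star (Sum.elim (fun i => w (Sum.inl i)) fun i => w (Sum.inr i)) =
        Sum.elim (star fun i => w (Sum.inl i)) (star fun i => w (Sum.inr i)) from by
          ext i; rcases i with i | i <;> rfl,
      sumElim_dotProduct_sumElim, dotProduct_zero, zero_add] at h0
    simp only [dotProduct, Pi.star_apply, Complex.star_def, mulVec_diagonal] at h0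
    have h0' : ∑ i : Fin n, (((2 * lam * m i * bathTemp n T_L T_R i) *
        Complex.normSq (w (Sum.inr i)) : ℝ) : ℂ) = 0 := by
      rw [← h0]
      push_cast
      refine Finset.sum_congr rfl fun i _ => ?_
      rw [Complex.normSq_eq_conj_mul_self]
      ring
    have h0'' : ∑ i : Fin n, (2 * lam * m i * bathTemp n T_L T_R i) *
        Complex.normSq (w (Sum.inr i)) = 0 := by
      exact_mod_cast h0'
    exact fun i => ((Finset.sum_eq_zero_iff_of_nonneg fun i _ =>
      mul_nonneg (hdiag_nn i) (Complex.normSq_nonneg _)).mp h0'') i (Finset.mem_univ i)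
  have hSw : ∀ w ∈ K, Sc *ᵥ w = 0 := by
    intro w hw
    have hsplit : w = Sum.elim (fun i => w (Sum.inl i)) (fun i => w (Sum.inr i)) := by
      ext i; rcases i with i | i <;> rfl
    rw [hSc', hsplit, fromBlocks_mulVec]
    simp only [Sum.elim_comp_inl, Sum.elim_comp_inr, zero_mulVec, zero_add]
    ext i
    rcases i with i | i
    · rfl
    · simp only [Sum.elim_inr, Pi.zero_apply, mulVec_diagonal]
      rcases mul_eq_zero.mp (hnoise w hw i) with h1 | h1
      · rw [h1]; simp
      · rw [Complex.normSq_eq_zero.mp h1, mul_zero]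
  have hleft : ∀ w ∈ K, ∀ i : Fin n, i.val = 0 → w (Sum.inr i) = 0 := by
    intro w hw i hi
    have h := hnoise w hw i
    have hpos : 0 < 2 * lam * m i * bathTemp n T_L T_R i := by
      have := hm i
      have hbt : 0 < bathTemp n T_L T_R i := by
        simp only [bathTemp, hi, if_true]
        split_ifs <;> linarith
      positivity
    rcases mul_eq_zero.mp h with h1 | h1
    · exact absurd h1 hpos.ne'
    · exact Complex.normSq_eq_zero.mp h1
  -- `K` is invariant under `Acᵀ`
  have hinv : ∀ w ∈ K, Matrix.toLin' Acᵀ w ∈ K := by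
    intro w hw
    have hw' := (hmemK w).mp hw
    rw [hmemK, Matrix.toLin'_apply, mulVec_mulVec]
    have := congrArg (fun M => M *ᵥ w) hlyap
    simp only [add_mulVec, zero_mulVec, ← mulVec_mulVec, hw', mulVec_zero, zero_add, hSw w hw,
      add_zero] at this
    rw [mulVec_mulVec] at this
    exact this
  -- an eigenvector of `Acᵀ` inside `K`
  haveI : Nontrivial K := Submodule.nontrivial_iff_ne_bot.mpr hKne
  set g : Module.End ℂ K := (Matrix.toLin' Acᵀ).restrict hinv with hg
  obtain ⟨c, hc⟩ := Module.End.exists_eigenvalue g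
  obtain ⟨⟨k, hkK⟩, hk⟩ := hc.exists_hasEigenvector
  have hk0 : k ≠ 0 := fun h => hk.2 (Subtype.ext h)
  have hkeig : Acᵀ *ᵥ k = c • k := by
    have h := hk.apply_eq_smul
    have h' := congrArg Subtype.val h
    rw [hg, LinearMap.coe_restrict_apply, Matrix.toLin'_apply] at h'
    exact h'
  -- block form of the eigenvector equation
  set u : Fin n → ℂ := fun i => k (Sum.inl i) with hu
  set w : Fin n → ℂ := fun i => k (Sum.inr i) with hw
  have hk_eq : k = Sum.elim u w := by
    ext i; rcases i with i | i <;> rfl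
  rw [hAcT, hk_eq, fromBlocks_mulVec] at hkeig
  have h1 : ∀ i, -(clForceMatrix n *ᵥ w) i = c * u i := by
    intro i
    have := congrFun hkeig (Sum.inl i)
    simpa [neg_mulVec] using this
  have h2 : ∀ i, ((m i : ℂ))⁻¹ * u i - lam * bathMult n i * w i = c * w i := by
    intro i
    have := congrFun hkeig (Sum.inr i)
    simpa [neg_mulVec, sub_eq_add_neg, mulVec_diagonal, frictionMatrix] using this
  have hm0 : ∀ i, (m i : ℂ) ≠ 0 := fun i => Complex.ofReal_ne_zero.mpr (hm i).ne'
  have hu_eq : ∀ i, u i = (m i : ℂ) * (c * w i + lam * bathMult n i * w i) := by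
    intro i
    have e2 := h2 i
    have hmi := hm0 i
    have e3 : u i = (m i : ℂ) * (((m i : ℂ))⁻¹ * u i) := by
      rw [← mul_assoc, mul_inv_cancel₀ hmi, one_mul]
    have e4 : ((m i : ℂ))⁻¹ * u i = c * w i + lam * bathMult n i * w i := by
      linear_combination e2
    rw [e3, e4]
  have hvec : ∀ i, (clForceMatrix n *ᵥ w) i +
      (c ^ 2 * (m i : ℂ) + c * lam * bathMult n i * m i) * w i = 0 := by
    intro i
    have e1 := h1 i
    rw [hu_eq i] at e1
    linear_combination -e1
  have hw0 : w = 0 :=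
    cl_chain_propagation _ w (fun a _ => hvec a) (fun a ha => hleft k hkK a ha)
  have hu0 : u = 0 := by
    funext i
    rw [hu_eq i, hw0]
    simp
  apply hk0
  rw [hk_eq, hu0, hw0]
  ext i; cases i <;> rfl

/-- **The stationary covariance of the Casher–Lebowitz chain is positive definite** for
`m > 0`, `λ > 0`, `T_L, T_R > 0` (so the stationary Gaussian state has a density). Along the
segment of temperatures from `(T_L, T_L)` (Gibbs, positive definite) to `(T_L, T_R)` the
covariances are symmetric with trivial kernel, so positivity propagates (`posDef_of_segment`).
[cite: Dhar2008, §3.1] -/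
theorem clCov_posDef {m : Fin n → ℝ} (hm : ∀ k, 0 < m k) {lam : ℝ} (hlam : 0 < lam)
    {T_L T_R : ℝ} (hL : 0 < T_L) (hR : 0 < T_R) : (clCov m lam T_L T_R).PosDef := by
  have hseg : ∀ s : ℝ, clCov m lam T_L T_L + s • (clCov m lam T_L T_R - clCov m lam T_L T_L) =
      clCov m lam T_L ((1 - s) * T_L + s * T_R) := by
    intro s
    rw [clCov_eq_add hm hlam T_L T_L, clCov_eq_add hm hlam T_L T_R,
      clCov_eq_add hm hlam T_L ((1 - s) * T_L + s * T_R)]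
    module
  refine posDef_of_segment (K₀ := clCov m lam T_L T_L) ?_ (clCov_transpose hm hlam T_L T_R)
    fun s hs v hv => ?_
  · rw [clCov_self hm hlam T_L]
    exact (clGibbsCov_posDef hm).smul hL
  · rw [hseg s] at hv
    refine clCov_mulVec_eq_zero hm hlam hL ?_ hv
    have h1 : 0 ≤ 1 - s := by linarith [hs.2]
    nlinarith [hs.1, h1, hL, hR]

end Literature.Barriers.AtomisticToContinuum.HeatConduction

end
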